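import Mathlib.Geometry.Manifold.Diffeomorph
import Mathlib.Topology.Homotopy.Contractible
import Literature.Geometry.Symplectic.StandardEnd
import HarnessLib

/-!
# Gromov: a symplectic 4-manifold standard at infinity without topology is `ℝ⁴`

Named fact (D-0014) requested by route SmoothPoincare4/SymplecticCap (`wi-03915`), in the
"standard at infinity" packaging of `StandardEnd.lean` (`Literature.Geometry.Symplectic.punctured`,
`Literature.Geometry.Symplectic.IsSymplecticStandardNearPoint`), which is the form the route's items 0427/0428 use.

**Gromov's theorem** (Invent. Math. 82 (1985), §0.3.C; McDuff–Salamon, *J-holomorphic curves and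
symplectic topology*, 2nd ed., Thm. 9.4.2; the filling versions are McDuff 1990, Thm. 1.7 and
Eliashberg 1990, Thm. 5.1): a connected symplectic 4-manifold `(V, ω)` which outside a compact set
is symplectomorphic to the complement of a compact set in `(ℝ⁴, ω₀)`, and which contains no
symplectic exceptional sphere (in particular if `H₂(V; ℤ) = 0`), is symplectomorphic to
`(ℝ⁴, ω₀)`.

We record the instance the route needs and nothing stronger:

* `V = M ∖ {p}` for a smooth 4-manifold `M` and a point `p`, with a smooth closed non-degenerate
  2-form `sf` on `V` which on a punctured chart-ball at `p` is the pullback of `ι*ω₀`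
  (`IsSymplecticStandardNearPoint p ε sf`) — i.e. `(V, sf)` is symplectically standard at the end
  `p` (the inversion `ι` carries a punctured ball onto the complement of a ball in `ℝ⁴`);
* the topological hypothesis is `ContractibleSpace V` (so `H₂(V) = 0`: no exceptional spheres;
  this is the situation of a homotopy 4-sphere `M`);
* the conclusion is only the DIFFEOMORPHISM type: `V` is diffeomorphic to `ℝ⁴`
  (`Nonempty (V ≃ₘ⟮𝓡 4, 𝓡 4⟯ ℝ⁴)`), weaker than Gromov's symplectomorphism. No control of the
  diffeomorphism near the end is asserted (whether it can be taken standard near `p` — which is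
  what closing up to `M ≅ S⁴` would need — is NOT part of this fact).

The strong- and weak-FILLING formulations (McDuff 1990, Thm. 1.7; Eliashberg 1990, Thm. 5.1: a minimal
symplectic filling of `(S³, ξ_std)` is diffeomorphic to `B⁴`) need contact-structure vocabulary on
`∂W` (contactomorphism with the standard `S³`) that the tree does not have; they are not recorded
here (`IsLiouvilleDomain` of `SteinDomain.lean` gives the convex-boundary side only).

## References

* M. Gromov, *Pseudo holomorphic curves in symplectic manifolds*, Invent. Math. 82 (1985)
  307–347, §0.3.C [Gromov1985].
* D. McDuff, D. Salamon, *J-holomorphic curves and symplectic topology*, 2nd ed., AMS 2012,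
  Thm. 9.4.2 [McDuffSalamon2012].
* D. McDuff, *The structure of rational and ruled symplectic 4-manifolds*, J. AMS 3 (1990),
  Thm. 1.7 [McDuff1990]; Y. Eliashberg, *Filling by holomorphic discs and its applications*
  (1990), Thm. 5.1 [Eliashberg1990].
-/

noncomputable section

open scoped Manifold ContDiff
open TopologicalSpace

namespace Literature.Geometry.Symplectic

/-- Local notation for the model space `ℝ⁴ = EuclideanSpace ℝ (Fin 4)`. -/
local notation "E4" => EuclideanSpace ℝ (Fin 4)

/-- **Gromov (1985), 0.3.C — instance for a punctured 4-manifold, diffeomorphism conclusion.**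
Let `M` be a smooth 4-manifold (Hausdorff, second countable, `C^∞` atlas on `ℝ⁴`), `p ∈ M`, and
`sf` a symplectic form on `V = M ∖ {p}` standard near `p` (`IsSymplecticStandardNearPoint p ε sf`).
If `V` is contractible, then `V` is diffeomorphic to `ℝ⁴`. (Gromov/McDuff–Salamon conclude
symplectomorphic to `(ℝ⁴, ω₀)` under "no exceptional sphere", implied by contractibility; only
the diffeomorphism type is recorded.) [cite: Gromov1985, §0.3.C] [cite: McDuffSalamon2012, Thm. 9.4.2] -/
def gromov_puncturedStandard_diffeomorphic_R4 : Prop :=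
  ∀ (M : Type) [TopologicalSpace M] [T2Space M] [SecondCountableTopology M]
    [ChartedSpace E4 M] [IsManifold (𝓡 4) ∞ M] (p : M) (ε : ℝ)
    (sf : Literature.Geometry.Kaehler.MForm (𝓡 4) (punctured p) ℝ 2),
    IsSymplecticStandardNearPoint p ε sf → ContractibleSpace (punctured p) →
      Nonempty ((punctured p) ≃ₘ⟮𝓡 4, 𝓡 4⟯ E4)

/-- Consequence packaging for the route: under Gromov's fact, a contractible punctured manifold
carrying a symplectic form standard near the puncture is homeomorphic to `ℝ⁴` (forget smoothness).
[folklore] -/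
theorem gromov_puncturedStandard_diffeomorphic_R4.homeomorphic
    (h : gromov_puncturedStandard_diffeomorphic_R4) (M : Type) [TopologicalSpace M] [T2Space M]
    [SecondCountableTopology M] [ChartedSpace E4 M] [IsManifold (𝓡 4) ∞ M] (p : M) (ε : ℝ)
    (sf : Literature.Geometry.Kaehler.MForm (𝓡 4) (punctured p) ℝ 2) (hs : IsSymplecticStandardNearPoint p ε sf)
    (hc : ContractibleSpace (punctured p)) : Nonempty ((punctured p) ≃ₜ E4) :=
  (h M p ε sf hs hc).map fun Φ => Φ.toHomeomorph

end Literature.Geometry.Symplectic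

end
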